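import Mathlib
import HarnessLib
import Literature.MathematicalPhysics.QuantumLattice.KohnLuttinger
import Literature.MathematicalPhysics.QuantumLattice.FermiRG.FST2Hypotheses
import Summits.HubbardSuperconductivity.HubbardSuperconductivity.Theorems.WeakCouplingBCSKlCertTPrimePHReflectionMeasure
import Summits.HubbardSuperconductivity.HubbardSuperconductivity.Theorems.WeakCouplingBCSKlCertTPrimeConvexity

/-!
# WeakCouplingBCS — KL certificate, `t′` rows: FST II (A3) FAILS on the Γ-side inflection band (companion to `…KlCertTPrimeConvexity`)

Second half of the reader file «tprime-convexity-chart» (hubbard-klscan-idea-4 round 3; prestage sha16 9cb28683edaadc7b, crit-1 x-read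
PASS STATUS l.9836), split at the §3c boundary for the 400-line statement-form lint (p1 g23 pre-flight, STATUS l.9850); every
declaration is byte-identical to the x-read prestage, same namespace `…Theorems.KlTPrimeConvexity`.

CONTENTS. §3c the Hessian form of `e = ε_{t′} − μ` in coordinates (`klcc_hasFDerivAt_e`, `klcc_iteratedFDeriv_two_e`, `klcc_hessQuad_e`:
`FermiRG.hessQuad e p v = ε_xx v₀² + 2ε_xy v₀v₁ + ε_yy v₁²`, built on the tree's `klph_hasGradientAt_squareDispersion` /
`klph_gradient_squareDispersion`), `hessQuad_tvec` (`hessQuad e k (−ε_y, ε_x) = N(k)`), and `gammaSide_not_hypA3`: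
`¬ HypA3 (ε_{t′} − μ) ∧ ¬ HypA3 (μ − ε_{t′})` on the inflection band `μ_c(t′) < μ < 4t′`; §4 exact rational anchors for the scan's `t′` rows
(`μ_c(−0.1) = −0.784`, `μ_c(−0.2) = −1.472`, `μ_c(−0.3) = −1.968`), the inflection cell `(0.20, −0.1)` and the M-side cell `(1/8, −0.3)`.

Honest framing: statements about the one-band dispersion `squareDispersion 1 t′` and the typed hypothesis `FermiRG.HypA3` only; nothing here
asserts a Kohn–Luttinger margin at `t′ ≠ 0`, K₃, the window or superconductivity; a Kohn–Luttinger instability statement is not ODLRO and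
nothing here proves superconductivity in the Hubbard model; no `t′ ≠ 0` statement chains to the summit Statement (`squareDispersion 1 0`).

References: J. Feldman, M. Salmhofer, E. Trubowitz, Comm. Pure Appl. Math. 52 (1999) 273, hypothesis (A3) (tree: `FermiRG.FST2Hypotheses`);
J. González, F. Guinea, M. A. H. Vozmediano, Phys. Rev. Lett. 79 (1997) 3514; S. Fratini, F. Guinea, Phys. Rev. B 66 (2002) 125104, App. A.
-/

noncomputable section

-- the tree's namespace `Summit.<Summit>.<Problem>.Theorems` repeats the summit name by design (D-0017)
set_option linter.dupNamespace false

namespace Summit.HubbardSuperconductivity.HubbardSuperconductivity.Theorems.KlTPrimeConvexity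

open Real Set Literature.MathematicalPhysics.QuantumLattice

/-! ### §3c  Consequence for the TYPED engine hypothesis: FST II (A3) fails on the inflection band 

`Literature…FermiRG.HypA3 e := ∀ p ∈ fermiSurface e, ∀ v ≠ 0, ⟪∇e p, v⟫ = 0 → 0 < hessQuad e p v` is the hypothesis of every
typed FST II theorem (FST2Regularity: `GeomConstants` existence, Theorem 1.1, …); its only instance in the tree is `klfs_hypA3`
(`t′ = 0`, `-4 < μ < 0`).  Here: the Hessian form of `e = ε_{t′} - μ` in coordinates, and `KLInflectionTP tp μ → ¬ HypA3 e ∧ ¬ HypA3 (-e)`. -/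

/-- Coordinate projections as continuous linear functionals. [folklore] -/
def P0 : Momentum →L[ℝ] ℝ := PiLp.proj 2 (fun _ : Fin 2 => ℝ) (0 : Fin 2)
/-- The second coordinate projection `Momentum →L[ℝ] ℝ`. [folklore] -/
def P1 : Momentum →L[ℝ] ℝ := PiLp.proj 2 (fun _ : Fin 2 => ℝ) (1 : Fin 2)
/-- `P0 q = q 0`. [folklore] -/
@[simp] theorem P0_apply (q : Momentum) : P0 q = q 0 := rfl
/-- `P1 q = q 1`. [folklore] -/
@[simp] theorem P1_apply (q : Momentum) : P1 q = q 1 := rfl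

/-- `De(z) = ε_x(z)·P₀ + ε_y(z)·P₁` for `e = ε_{t′} - μ` (from the tree's `klph_hasGradientAt_squareDispersion`). [folklore] -/
theorem klcc_hasFDerivAt_e (tp μ : ℝ) (z : Momentum) :
    HasFDerivAt (fun q : Momentum => squareDispersion 1 tp q - μ)
      ((dx tp (z 0) (z 1)) • P0 + (dy tp (z 0) (z 1)) • P1) z := by
  have h := Summit.HubbardSuperconductivity.HubbardSuperconductivity.Theorems.klph_hasGradientAt_squareDispersion tp z
  rw [hasGradientAt_iff_hasFDerivAt] at h
  refine (h.sub_const μ).congr_fderiv ?_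
  ext q
  rw [InnerProductSpace.toDual_apply_apply]
  simp [PiLp.inner_apply, Fin.sum_univ_two, dx, dy]
  ring

/-- The Fréchet derivative of `e = ε_{t′} - μ` as a function. [folklore] -/
theorem klcc_fderiv_e (tp μ : ℝ) :
    fderiv ℝ (fun q : Momentum => squareDispersion 1 tp q - μ)
      = fun z : Momentum => (dx tp (z 0) (z 1)) • P0 + (dy tp (z 0) (z 1)) • P1 :=
  funext fun z => (klcc_hasFDerivAt_e tp μ z).fderiv

/-- `D(ε_x)(z) = ε_xx(z)·P₀ + ε_xy(z)·P₁`. [folklore] -/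
theorem klcc_hasFDerivAt_dx (tp : ℝ) (z : Momentum) :
    HasFDerivAt (fun q : Momentum => dx tp (q 0) (q 1))
      ((dxx tp (z 0) (z 1)) • P0 + (dxy tp (z 0) (z 1)) • P1) z := by
  have ha : HasFDerivAt (fun q : Momentum => 2 * Real.sin (P0 q)) ((2 * Real.cos (z 0)) • P0) z := by
    have h := ((Real.hasDerivAt_sin (P0 z)).comp_hasFDerivAt z P0.hasFDerivAt).const_mul (2 : ℝ)
    refine h.congr_fderiv ?_
    rw [smul_smul]; rfl
  have hb : HasFDerivAt (fun q : Momentum => 1 + 2 * tp * Real.cos (P1 q)) ((2 * tp * -Real.sin (z 1)) • P1) z := by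
    have h := (((Real.hasDerivAt_cos (P1 z)).comp_hasFDerivAt z P1.hasFDerivAt).const_mul (2 * tp)).const_add 1
    refine h.congr_fderiv ?_
    rw [smul_smul]; rfl
  have h := ha.mul hb
  refine HasFDerivAt.congr_fderiv (by exact h) ?_
  ext q
  simp [dxx, dxy]
  ring

/-- `D(ε_y)(z) = ε_xy(z)·P₀ + ε_yy(z)·P₁`. [folklore] -/
theorem klcc_hasFDerivAt_dy (tp : ℝ) (z : Momentum) :
    HasFDerivAt (fun q : Momentum => dy tp (q 0) (q 1))
      ((dxy tp (z 0) (z 1)) • P0 + (dyy tp (z 0) (z 1)) • P1) z := by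
  have ha : HasFDerivAt (fun q : Momentum => 2 * Real.sin (P1 q)) ((2 * Real.cos (z 1)) • P1) z := by
    have h := ((Real.hasDerivAt_sin (P1 z)).comp_hasFDerivAt z P1.hasFDerivAt).const_mul (2 : ℝ)
    refine h.congr_fderiv ?_
    rw [smul_smul]; rfl
  have hb : HasFDerivAt (fun q : Momentum => 1 + 2 * tp * Real.cos (P0 q)) ((2 * tp * -Real.sin (z 0)) • P0) z := by
    have h := (((Real.hasDerivAt_cos (P0 z)).comp_hasFDerivAt z P0.hasFDerivAt).const_mul (2 * tp)).const_add 1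
    refine h.congr_fderiv ?_
    rw [smul_smul]; rfl
  have h := ha.mul hb
  refine HasFDerivAt.congr_fderiv (by exact h) ?_
  ext q
  simp [dyy, dxy]
  ring

/-- `D²e(z) = (ε_xx P₀ + ε_xy P₁) ⊗ P₀ + (ε_xy P₀ + ε_yy P₁) ⊗ P₁`. [folklore] -/
theorem klcc_hasFDerivAt_fderiv_e (tp μ : ℝ) (z : Momentum) :
    HasFDerivAt (fderiv ℝ (fun q : Momentum => squareDispersion 1 tp q - μ))
      (((dxx tp (z 0) (z 1)) • P0 + (dxy tp (z 0) (z 1)) • P1).smulRight P0 +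
        ((dxy tp (z 0) (z 1)) • P0 + (dyy tp (z 0) (z 1)) • P1).smulRight P1) z := by
  rw [klcc_fderiv_e]
  exact ((klcc_hasFDerivAt_dx tp z).smul_const P0).add ((klcc_hasFDerivAt_dy tp z).smul_const P1)

/-- **The Hessian form of `e = ε_{t′} - μ`**: `(v, e″(p) w) = ε_xx v₀w₀ + ε_xy (v₀w₁ + v₁w₀) + ε_yy v₁w₁`. [folklore] -/
theorem klcc_iteratedFDeriv_two_e (tp μ : ℝ) (p v w : Momentum) :
    iteratedFDeriv ℝ 2 (fun q : Momentum => squareDispersion 1 tp q - μ) p ![v, w] =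
      (dxx tp (p 0) (p 1) * v 0 + dxy tp (p 0) (p 1) * v 1) * w 0
        + (dxy tp (p 0) (p 1) * v 0 + dyy tp (p 0) (p 1) * v 1) * w 1 := by
  rw [iteratedFDeriv_two_apply, (klcc_hasFDerivAt_fderiv_e tp μ p).fderiv]
  simp

/-- FST's quadratic form for the `t`–`t′` band: `hessQuad e p v = ε_xx v₀² + 2 ε_xy v₀ v₁ + ε_yy v₁²`. [folklore] -/
theorem klcc_hessQuad_e (tp μ : ℝ) (p v : Momentum) :
    FermiRG.hessQuad (fun q : Momentum => squareDispersion 1 tp q - μ) p v =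
      dxx tp (p 0) (p 1) * v 0 ^ 2 + 2 * dxy tp (p 0) (p 1) * v 0 * v 1 + dyy tp (p 0) (p 1) * v 1 ^ 2 := by
  rw [FermiRG.hessQuad, klcc_iteratedFDeriv_two_e]
  ring

/-- The tangency form: `⟪∇e(p), v⟫ = ε_x v₀ + ε_y v₁`. [folklore] -/
theorem klcc_inner_gradient_e (tp μ : ℝ) (p v : Momentum) :
    inner ℝ (gradient (fun q : Momentum => squareDispersion 1 tp q - μ) p) v =
      dx tp (p 0) (p 1) * v 0 + dy tp (p 0) (p 1) * v 1 := by
  have hg : gradient (fun q : Momentum => squareDispersion 1 tp q - μ) p = gradient (squareDispersion 1 tp) p := by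
    unfold gradient; rw [fderiv_sub_const]
  rw [hg, Summit.HubbardSuperconductivity.HubbardSuperconductivity.Theorems.klph_gradient_squareDispersion,
    PiLp.inner_apply, Fin.sum_univ_two]
  simp [dx, dy]
  ring

/-- The tangent vector `(-ε_y, ε_x)` at `(x, y)`. [folklore] -/
def tvec (tp x y : ℝ) : Momentum := mk (-(dy tp x y)) (dx tp x y)

/-- **`hessQuad e k (-ε_y, ε_x) = N(k)`**: FST's quadratic form on the tangent vector is the curvature numerator. [folklore] -/
theorem hessQuad_tvec (tp μ : ℝ) (k : Momentum) :
    FermiRG.hessQuad (fun q : Momentum => squareDispersion 1 tp q - μ) k (tvec tp (k 0) (k 1))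
      = curvNum tp (k 0) (k 1) := by
  rw [klcc_hessQuad_e]
  simp [tvec, curvNum]
  ring

/-- The tangent vector `(-ε_y, ε_x)` is orthogonal to the gradient. [folklore] -/
theorem inner_gradient_tvec (tp μ : ℝ) (k : Momentum) :
    inner ℝ (gradient (fun q : Momentum => squareDispersion 1 tp q - μ) k) (tvec tp (k 0) (k 1)) = 0 := by
  rw [klcc_inner_gradient_e]
  simp [tvec]
  ring

/-- A nonzero curvature numerator forces a nonzero tangent vector (i.e. a regular point). [folklore] -/
theorem tvec_ne_zero_of_curvNum_ne_zero {tp : ℝ} {k : Momentum} (h : curvNum tp (k 0) (k 1) ≠ 0) :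
    tvec tp (k 0) (k 1) ≠ 0 := by
  intro h0
  have h1 : dy tp (k 0) (k 1) = 0 := by
    have := congrArg (fun q : Momentum => q 0) h0
    simpa [tvec] using this
  have h2 : dx tp (k 0) (k 1) = 0 := by
    have := congrArg (fun q : Momentum => q 1) h0
    simpa [tvec] using this
  apply h
  simp [curvNum, h1, h2]

/-- **(A3) FAILS, Fermi-sea-convex orientation**: an inflection cell violates `HypA3 (ε_{t′} - μ)`. [folklore] -/
theorem not_hypA3_of_inflection {tp μ : ℝ} (h : KLInflectionTP tp μ) :
    ¬ FermiRG.HypA3 (fun q : Momentum => squareDispersion 1 tp q - μ) := by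
  intro hA
  obtain ⟨k, hk, -, -, hneg, -⟩ := h
  have hkS : k ∈ FermiRG.fermiSurface (fun q : Momentum => squareDispersion 1 tp q - μ) := by
    show squareDispersion 1 tp k - μ = 0
    rw [hk.2]; ring
  have hpos := hA k hkS _ (tvec_ne_zero_of_curvNum_ne_zero hneg.ne) (inner_gradient_tvec tp μ k)
  rw [hessQuad_tvec] at hpos
  linarith

/-- **(A3) FAILS, opposite orientation** (`-e`, hole-sea-convex): the same cell violates `HypA3 (μ - ε_{t′})` too. [folklore] -/
theorem not_hypA3_neg_of_inflection {tp μ : ℝ} (h : KLInflectionTP tp μ) :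
    ¬ FermiRG.HypA3 (fun q : Momentum => -(squareDispersion 1 tp q - μ)) := by
  intro hA
  obtain ⟨-, -, k, hk, -, hposN⟩ := h
  have hkS : k ∈ FermiRG.fermiSurface (fun q : Momentum => -(squareDispersion 1 tp q - μ)) := by
    show -(squareDispersion 1 tp k - μ) = 0
    rw [hk.2]; ring
  have hfun : (fun q : Momentum => -(squareDispersion 1 tp q - μ)) = -(fun q : Momentum => squareDispersion 1 tp q - μ) := rfl
  have horth : inner ℝ (gradient (fun q : Momentum => -(squareDispersion 1 tp q - μ)) k) (tvec tp (k 0) (k 1)) = 0 := by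
    rw [hfun]
    unfold gradient
    rw [fderiv_neg, map_neg, inner_neg_left]
    have := inner_gradient_tvec tp μ k
    unfold gradient at this
    rw [this, neg_zero]
  have hpos := hA k hkS _ (tvec_ne_zero_of_curvNum_ne_zero hposN.ne') horth
  rw [FermiRG.hessQuad, hfun, iteratedFDeriv_neg_apply, neg_apply] at hpos
  have := hessQuad_tvec tp μ k
  rw [FermiRG.hessQuad] at this
  rw [this] at hpos
  linarith

/-- **On the inflection band FST II (A3) fails in both orientations** (the 23 inflection nodes of KL-MARGIN-SCAN are instances). [folklore] -/
theorem gammaSide_not_hypA3 {tp μ : ℝ} (htp1 : -1 / 2 < tp) (htp0 : tp < 0)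
    (hlo : convexityReturnLevel tp < μ) (hhi : μ < 4 * tp) :
    ¬ FermiRG.HypA3 (fun q : Momentum => squareDispersion 1 tp q - μ) ∧
      ¬ FermiRG.HypA3 (fun q : Momentum => -(squareDispersion 1 tp q - μ)) :=
  ⟨not_hypA3_of_inflection (gammaSide_inflection htp1 htp0 hlo hhi),
    not_hypA3_neg_of_inflection (gammaSide_inflection htp1 htp0 hlo hhi)⟩

/-- Scan cell `(δ, t′) = (0.20, -0.1)` (`μ = -0.6148`, inside margin-1's certified bracket `[-0.6148, -0.6147]`): FST II (A3)
FAILS for `ε_{-0.1} - μ`. [folklore] -/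
theorem not_hypA3_cell_d020_tpm01 : ¬ FermiRG.HypA3 (fun q : Momentum => squareDispersion 1 (-1 / 10) q - (-6148 / 10000)) :=
  (gammaSide_not_hypA3 (by norm_num) (by norm_num) (by norm_num [convexityReturnLevel]) (by norm_num)).1

/-! ### §4  Numerical anchors of the chart (exact rationals; the scan's `t′` rows) -/

/-- `μ_c(-0.1) = -0.784` (scan row `t′ = -0.1`). [folklore] -/
theorem convexityReturnLevel_m01 : convexityReturnLevel (-1 / 10) = -784 / 1000 := by norm_num [convexityReturnLevel]
/-- `μ_c(-0.2) = -1.472` (scan row `t′ = -0.2`). [folklore] -/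
theorem convexityReturnLevel_m02 : convexityReturnLevel (-2 / 10) = -1472 / 1000 := by norm_num [convexityReturnLevel]
/-- `μ_c(-0.3) = -1.968` (scan row `t′ = -0.3`). [folklore] -/
theorem convexityReturnLevel_m03 : convexityReturnLevel (-3 / 10) = -1968 / 1000 := by norm_num [convexityReturnLevel]

/-- Scan cell `(δ, t′) = (0.20, -0.1)` has `μ ∈ [-0.6148, -0.6147]` (margin-1 bracket), inside `(μ_c, 4t′) = (-0.784, -0.4)`:
an inflection cell. [folklore] -/
theorem inflection_cell_d020_tpm01 : KLInflectionTP (-1 / 10) (-6148 / 10000) :=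
  gammaSide_inflection (by norm_num) (by norm_num) (by norm_num [convexityReturnLevel]) (by norm_num)

/-- The director's first `t′` target `(δ, t′) = (1/8, -0.3)` has `μ ≈ -0.9596 > 4t′ = -1.2` — M side, OUTSIDE the inflection band
(float: strictly convex, `|κ| ≥ 0.27`); `gammaSide_inflection` is silent there, as it should be. [folklore] -/
theorem cell_d0125_tpm03_above_vanHove : ¬ ((-9596 : ℝ) / 10000 < 4 * (-3 / 10)) := by norm_num

end Summit.HubbardSuperconductivity.HubbardSuperconductivity.Theorems.KlTPrimeConvexity

end
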